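import Mathlib

/-!
# Objects of the line `polytrope-kr-planar-dimers` for the crux `DivisionGap.ShadowBirkhoff`
(stmt-ValiantsHypothesis-5069)

Definitions file (D-0016 `<RouteSlug>Defs` pattern) for the four registered stubs of the crux skeleton
`Cruxes/ShadowBirkhoff/Lines/polytrope_kr_planar_dimers.lean` (line lead prover-line-stmt-ValiantsHypothesis-5069-a1-0):
the objects are copied VERBATIM from the registered skeleton so that the stub theorems landed under
`Theorems/DivisionGapShadowBirkhoffStub*.lean` carry literally the registered signatures.

* `patternPoints n Z`, `patternShadowVertexCount Z L` — permutation matrices inside a 0/1 pattern `Z` (a face of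
  the Birkhoff polytope `DS_n`, same matrix encoding as the crux: entry `(i, j) = 1` iff `ρ j = i`) and the number
  of vertices of their planar shadow under a linear `L`.
* `IsGridAdjacent`, `dominoPoints k`, `dominoShadowVertexCount L` — domino tilings of the `k × k` board as 0/1
  points (graphs of fixed-point-free grid-adjacent involutions) and their shadow vertex counts.
* `LatticePt m`, `IsBoundaryPt`, `VertOK`, `HorizOK`, `heightPoints m`, `heightShadowVertexCount Λ` — Thurston's
  reduced height functions of the `2m × 2m` board (integer points of the Lipschitz polytrope `LIP_m`: zero on the
  boundary, two-sided 0/1 difference constraints along lattice edges; conventions in the docstrings, machine-checked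
  for `2m ≤ 8` by the crux planner, evidence `check_lip.py` on the item) and their shadow vertex counts.
* `pencilValue w g t`, `uniqueMaximisers m w` — the pencil `w₁ + t·w₂` of lattice-point weights evaluated at a
  height function, and the height functions that are its unique maximiser at some parameter (the break points of
  the parametric maximum).

Nothing is asserted here (definitions only).  References: W. P. Thurston, *Conway's tiling groups*, Amer. Math.
Monthly 97 (1990) 757–773; J. Propp, *Lattice structure for orientations of graphs*, arXiv:math/0209005, Thm 2;
P. Hrubeš, A. Yehudayoff, *Shadows of Newton polytopes*, CCC 2021 (Open Problem 1) [HrubesYehudayoff2021].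
-/

set_option linter.dupNamespace false

noncomputable section

namespace Summit.ValiantsHypothesis.ValiantsHypothesis.Theorems.DivisionGapShadowBirkhoff

/-- Permutation matrices inside a 0/1 pattern `Z` (perfect matchings of the bipartite graph `Z`; a face of
`DS_n`).  Same encoding as the crux: entry `(i, j) = 1` iff `ρ j = i`. -/
def patternPoints (n : ℕ) (Z : Set (Fin n × Fin n)) : Set (Fin n × Fin n → ℝ) :=
  {x | ∃ ρ : Equiv.Perm (Fin n), (∀ j, (ρ j, j) ∈ Z) ∧ x = fun ij => if ρ ij.2 = ij.1 then 1 else 0}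

/-- Shadow vertex count of the pattern face `Z` under `L`: the number of extreme points of the convex hull of
the projected pattern permutation matrices. -/
def patternShadowVertexCount {n : ℕ} (Z : Set (Fin n × Fin n))
    (L : (Fin n × Fin n → ℝ) →ₗ[ℝ] (Fin 2 → ℝ)) : ℕ :=
  (Set.extremePoints ℝ (convexHull ℝ (L '' patternPoints n Z))).ncard

/-- Grid adjacency of cells of the `k × k` board (cells differ by one in exactly one coordinate). -/
def IsGridAdjacent {k : ℕ} (v w : Fin k × Fin k) : Prop :=
  (((v.1 : ℕ) + 1 = w.1 ∧ v.2 = w.2) ∨ ((w.1 : ℕ) + 1 = v.1 ∧ v.2 = w.2) ∨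
    (v.1 = w.1 ∧ (v.2 : ℕ) + 1 = w.2) ∨ (v.1 = w.1 ∧ (w.2 : ℕ) + 1 = v.2))

/-- Domino tilings of the `k × k` board as points of `ℝ^{V × V}`, `V = Fin k × Fin k`: the indicator of the
graph of a fixed-point-free grid-adjacent involution (meaningful at even `k = 2m`; at odd `k ≥ 1` the set is
empty, at `k = 0` it is the single empty tiling). -/
def dominoPoints (k : ℕ) : Set ((Fin k × Fin k) × (Fin k × Fin k) → ℝ) :=
  {x | ∃ f : Fin k × Fin k → Fin k × Fin k,
    (∀ v, f (f v) = v ∧ f v ≠ v ∧ IsGridAdjacent v (f v)) ∧ x = fun e => if f e.1 = e.2 then 1 else 0}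

/-- Shadow vertex count of the domino polytope of the `k × k` board under `L`. -/
def dominoShadowVertexCount {k : ℕ}
    (L : ((Fin k × Fin k) × (Fin k × Fin k) → ℝ) →ₗ[ℝ] (Fin 2 → ℝ)) : ℕ :=
  (Set.extremePoints ℝ (convexHull ℝ (L '' dominoPoints k))).ncard

/-- Lattice points `(a, b)`, `0 ≤ a, b ≤ 2m`, of the `2m × 2m` board (cell `(i, j)` is the unit square
`[i, i+1] × [j, j+1]`, black iff `i + j` is even). -/
abbrev LatticePt (m : ℕ) := Fin (2 * m + 1) × Fin (2 * m + 1)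

/-- Boundary lattice points of the `2m × 2m` board. -/
def IsBoundaryPt (m : ℕ) (p : LatticePt m) : Prop :=
  (p.1 : ℕ) = 0 ∨ (p.1 : ℕ) = 2 * m ∨ (p.2 : ℕ) = 0 ∨ (p.2 : ℕ) = 2 * m

/-- Constraint on the vertical lattice edge of column `a` between `(a, b)` and `(a, b+1)`, for the reduced height
`g` (`h = h₀ + 4g`, `h₀` = Thurston height of the all-horizontal brick tiling `T₀`): with `δ = g(a,b+1) − g(a,b)` and
`χ = [a odd]` (`T₀` crosses exactly the vertical lattice edges in odd columns), `χ − 1 ≤ δ ≤ χ` if the west cell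
`(a−1, b)` is black (`a + b` odd), `−χ ≤ δ ≤ 1 − χ` otherwise. -/
def VertOK (m : ℕ) (g : LatticePt m → ℝ) (a : Fin (2 * m + 1)) (b : Fin (2 * m)) : Prop :=
  let δ := g (a, b.succ) - g (a, b.castSucc)
  let χ : ℝ := if (a : ℕ) % 2 = 1 then 1 else 0
  if ((a : ℕ) + b) % 2 = 1 then χ - 1 ≤ δ ∧ δ ≤ χ else -χ ≤ δ ∧ δ ≤ 1 - χ

/-- Constraint on the horizontal lattice edge of row `b` between `(a, b)` and `(a+1, b)`: with
`δ = g(a+1,b) − g(a,b)`, `−1 ≤ δ ≤ 0` if the north cell `(a, b)` is black (`a + b` even), `0 ≤ δ ≤ 1` otherwise. -/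
def HorizOK (m : ℕ) (g : LatticePt m → ℝ) (a : Fin (2 * m)) (b : Fin (2 * m + 1)) : Prop :=
  let δ := g (a.succ, b) - g (a.castSucc, b)
  if ((a : ℕ) + b) % 2 = 0 then -1 ≤ δ ∧ δ ≤ 0 else 0 ≤ δ ∧ δ ≤ 1

/-- The HEIGHT FUNCTIONS of the `2m × 2m` board = the integer points of the Lipschitz polytrope
`LIP_m = {g : g|∂ = 0, d_pq − 1 ≤ g(q) − g(p) ≤ d_pq}` (a difference-constraint = alcoved polytope); in bijection
with the domino tilings of the board (Thurston 1990; Propp, arXiv:math/0209005 Thm 2). -/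
def heightPoints (m : ℕ) : Set (LatticePt m → ℝ) :=
  {g | (∀ p, ∃ z : ℤ, g p = z) ∧ (∀ p, IsBoundaryPt m p → g p = 0) ∧
    (∀ a b, VertOK m g a b) ∧ (∀ a b, HorizOK m g a b)}

/-- Shadow vertex count of the height functions under a linear `Λ` (pair of point-weight functionals). -/
def heightShadowVertexCount {m : ℕ} (Λ : (LatticePt m → ℝ) →ₗ[ℝ] (Fin 2 → ℝ)) : ℕ :=
  (Set.extremePoints ℝ (convexHull ℝ (Λ '' heightPoints m))).ncard

/-- Value of the pencil `w₁ + t·w₂` of point weights at the height function `g`. -/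
def pencilValue {m : ℕ} (w : LatticePt m → ℝ × ℝ) (g : LatticePt m → ℝ) (t : ℝ) : ℝ :=
  ∑ p, ((w p).1 + t * (w p).2) * g p

/-- Height functions that are the UNIQUE maximiser of the pencil at some parameter `t` (= the break points /
linearity pieces of `t ↦ max_g ⟨w₁ + t w₂, g⟩`, i.e. of the parametric Kantorovich–Rubinstein norm
`t ↦ ‖w₁ + t w₂‖_KR` on the planar dual by LP duality for difference constraints). -/
def uniqueMaximisers (m : ℕ) (w : LatticePt m → ℝ × ℝ) : Set (LatticePt m → ℝ) :=
  {g | g ∈ heightPoints m ∧ ∃ t : ℝ, ∀ g' ∈ heightPoints m, g' ≠ g → pencilValue w g' t < pencilValue w g t}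

/-- Sanity (non-vacuity of the dictionary): the reduced height `g = 0` (the brick tiling `T₀` itself) is a height
function of every board. -/
theorem zero_mem_heightPoints (m : ℕ) : (fun _ => (0 : ℝ)) ∈ heightPoints m := by
  refine ⟨fun _ => ⟨0, by simp⟩, fun _ _ => rfl, fun a b => ?_, fun a b => ?_⟩
  · simp only [VertOK, sub_self]
    split_ifs <;> norm_num
  · simp only [HorizOK, sub_self]
    split_ifs <;> norm_num

end Summit.ValiantsHypothesis.ValiantsHypothesis.Theorems.DivisionGapShadowBirkhoff

end
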